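import Summits.ABC.IUTFork.Joshi.PrototypeExponentModel
import Summits.ABC.IUTFork.Joshi.MochizukiAnsatzLocal
import HarnessLib

/-!
# `EtaPtTeich` («`η_{K_{y_a}}([a]) = p`», [J-IIp] Lem. 6.10.1) FORCES the point map `a ↦ y_a` to see more than `|a|_F`:
# a no-go lemma over E-t3's signature, and its instance — the hypothesis is FALSE in the exponent model

Test-side support file of the abc-iut cell, block E «type Joshi's construction, test vs S» (rung LADDER-ABC:A2.E; seat
abc-iut-E-t57, gen 2, the [J-IIp] MODEL / NV seat of plan/E/ASSIGNMENTS.md §2d; vacuity-census companion of abc-iut-E-t2's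
`Joshi/PrimitiveAnsatzPointsModel.lean` (p437626, a model of `EtaPtTeich` over E-t3's O1 carriers) and of this seat's
`Joshi/PrototypeExponentModel.lean` (p434861, the Frobenius-bijective EXPONENT model of the same carriers), both imported or
referred to BY NAME; nothing is restated). NOTHING here is a claim about Joshi's or Mochizuki's mathematics; no side is taken
on [IUTchIII] Cor. 3.12 or on any author; a model exhibits (un)satisfiability of TYPED hypotheses, nothing more.

SOURCE of the hypothesis (as typed by E-t2, `Summit.ABC.IUTFork.Joshi.PeriodRingDatum.EtaPtTeich`, `Joshi/MochizukiAnsatzLocal`):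
K. Joshi, *Construction of Arithmetic Teichmuller Spaces II: Proof of a local prototype of Mochizuki's Corollary 3.12*,
arXiv:2303.01662 **v3** (UNREFEREED; bib `Joshi2023ATS2Local`), Lem. 6.10.1, p. 18 l. 11–15 of the cell render
`HOME/lit/renders/Joshi-arxiv-2303.01662/p0018.txt` («one can choose a primitive element of degree one of `([p^♭] − p) ⊂ W(𝒪_F)`
which generates the prime ideal `ker(η_K : W(𝒪_F) ↠ 𝒪_K)` defining the point»), used with [FF18, Déf. 2.2.1]: at the point `y_a`
of `[a] − p`, `η_{K_{y_a}}([a]) = p` (`0 ≠ a ∈ 𝔪_F`).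

## Contents

1. **No-go over the signature** (`PeriodRingDatum.not_etaPtTeich_of_pt_eq_of_absF_eq`): let `D` be ANY `PeriodRingDatum`, `a` an
   admissible parameter (`a ≠ 0`, `|a|_F < 1`) such that (i) every `x` with `|x|_F = |a|_F` has the SAME point `y_x = y_a`, and
   (ii) the residue field `K_{y_a}` has an element `ξ ≠ p` with `|ξ|_{K_{y_a}} = |a|_F`. Then `¬ EtaPtTeich`. Proof (four lines of
   the signature): by (A2) `exists_teich_lift`, `ξ = η_{y_a}([x])` for some `x`; by (A1) `absK_eta_teich`, `|x|_F = |ξ| = |a|_F`, so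
   `x` is admissible and by (i) `y_x = y_a`; `EtaPtTeich` at `x` gives `η_{y_a}([x]) = p`, i.e. `ξ = p` — contradiction.
   Contrapositive (`exists_absF_eq_and_pt_ne_of_etaPtTeich`): under `EtaPtTeich` (and (ii)), the point map SEPARATES two
   parameters of the same absolute value — `a ↦ y_a` is not a function of `|a|_F`.
2. **Instance: the exponent model refutes `EtaPtTeich`** (`ExpModel.not_etaPtTeich`): in `ExpModel.periodRingDatum p` the point of
   `[a] − p` is the valuation exponent `e(a) = log‖a‖/log‖p‖` (so (i) holds on the nose, `ExpModel.pt_eq_of_absF_eq`), and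
   `K_{e(p)} = Q̄_p ∋ ξ := p + p²` has `‖ξ‖ = ‖p‖`, `ξ ≠ p` ((ii)). Hence `EtaPtTeich` is FALSE there — for the model AS BUILT, and, by
   item 1, for EVERY re-choice of its Teichmüller field keeping the point map and the residue fields (E-t2's transposition trick of
   p437626, which repairs E-t3's O1 model, has no analogue on exponent-valued points).

## What this locates (vacuity census of the [J-IIp] lane; numbers, no verdict)

With p436434 (`Joshi/PrimitiveAnsatzFrobeniusIndependence`: the `ϕ^{−1}`-clause of Prop. 6.6.1 — E-t7's
`PrimAnsatzFrobeniusInvariant` in `↔` form — is FALSE in E-t3's O1 model and TRUE in the exponent model) and p437626 (E-t2: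
`EtaPtTeich` TRUE in the transposed O1 model `Model.prototypeDatumEta`, whose point-Frobenius `y ↦ y^p` on `Q̄_p` is the O1 one,
not injective): of the two named [J-IIp] §6 hypotheses { `EtaPtTeich`, `ϕ^{−1}`-clause }, EACH model of record carries exactly
ONE. Whether E-t3's signature admits a model carrying BOTH (equivalently: `EtaPtTeich` jointly with a BIJECTIVE point-Frobenius)
is not decided by the files of record; item 1 says such a model must have a point map finer than the valuation — e.g. points =
classes of `𝔪_F ∖ 0` modulo `p`-power roots of unity (the coarsest point structure on which `a ↦ a^p` descends to a bijection).
Gen-0's located observation in p434861 («the typed [J-IIp] signature is satisfied by a model retaining nothing but valuation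
exponents») is thereby REFINED: it holds for E-t3's signature and E-t7's four inputs (p435471), and FAILS once E-t2's `EtaPtTeich`
is added — `EtaPtTeich` is the first typed [J-IIp] hypothesis of record that is not exponent bookkeeping. [folklore]
-/

noncomputable section

open Set

namespace Summit.ABC.IUTFork.Joshi

/-! ## 1. The no-go lemma over E-t3's signature -/

namespace PeriodRingDatum

variable {F B E0 : Type} [Field F] [CommRing B] [Field E0] {Y : Type} {K : Y → Type} [∀ y, Field (K y)] {G : Type}
  (D : PeriodRingDatum F B E0 Y K G)

/-- **No-go.** If the point map of `D` is constant on the sphere `{|x|_F = |a|_F}` of an admissible parameter `a` and the residue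
field `K_{y_a}` has an element `ξ ≠ p` of absolute value `|a|_F`, then `EtaPtTeich` fails: (A2) lifts `ξ` to some `[x]`, (A1) puts
`x` on the sphere, so `y_x = y_a` and `EtaPtTeich` at `x` forces `ξ = η_{y_a}([x]) = p`. [folklore] -/
theorem not_etaPtTeich_of_pt_eq_of_absF_eq {a : F} (ha0 : a ≠ 0) (ha1 : D.absF a < 1)
    (hfib : ∀ x : F, D.absF x = D.absF a → D.pt x = D.pt a)
    {ξ : K (D.pt a)} (hξ : D.absK (D.pt a) ξ = D.absF a) (hne : ξ ≠ (D.p : K (D.pt a))) : ¬ D.EtaPtTeich := by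
  intro h
  obtain ⟨x, hx⟩ := D.exists_teich_lift (D.pt a) ξ (by rw [hξ]; exact ha1.le)
  have hxa : D.absF x = D.absF a := by rw [← D.absK_eta_teich (D.pt a) x, hx, hξ]
  have hx0 : x ≠ 0 := by
    intro h0
    rw [h0, D.absF.map_zero] at hxa
    exact ha0 (D.absF.eq_zero.1 hxa.symm)
  have hx1 : D.absF x < 1 := by rw [hxa]; exact ha1
  have key : ∀ y, D.pt x = y → D.eta y (D.teich x) = (D.p : K y) := by
    rintro y rfl
    exact h x hx0 hx1
  exact hne (hx.symm.trans (key (D.pt a) (hfib x hxa)))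

/-- **Contrapositive (what `EtaPtTeich` forces).** Under `EtaPtTeich`, if `K_{y_a}` has an element `ξ ≠ p` with `|ξ| = |a|_F`, then
some parameter `x` with `|x|_F = |a|_F` has a DIFFERENT point `y_x ≠ y_a`: the point map `a ↦ y_a` is not a function of the
absolute value `|a|_F`. [folklore] -/
theorem exists_absF_eq_and_pt_ne_of_etaPtTeich (h : D.EtaPtTeich) {a : F} (ha0 : a ≠ 0) (ha1 : D.absF a < 1)
    {ξ : K (D.pt a)} (hξ : D.absK (D.pt a) ξ = D.absF a) (hne : ξ ≠ (D.p : K (D.pt a))) :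
    ∃ x : F, D.absF x = D.absF a ∧ D.pt x ≠ D.pt a := by
  by_contra hcon
  push Not at hcon
  exact D.not_etaPtTeich_of_pt_eq_of_absF_eq ha0 ha1 hcon hξ hne h

end PeriodRingDatum

/-! ## 2. The instance: `EtaPtTeich` is FALSE in the exponent model -/

namespace ExpModel

open Summit.ABC.IUTFork.Joshi.Model

variable (p : ℕ) [hp : Fact p.Prime]

/-- In the exponent model the point `e(a)` of `[a] − p` depends only on `‖a‖`. [folklore] -/
theorem expQ_eq_of_norm_eq {x a : PadicAlgCl p} (h : ‖x‖ = ‖a‖) : expQ p x = expQ p a := by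
  unfold expQ
  rw [h]
  split_ifs with hc
  · have ha : a ≠ 0 := norm_pos_iff.1 hc.1
    have hx : x ≠ 0 := norm_pos_iff.1 (h ▸ hc.1)
    rw [normExp_eq_of_norm_eq p hx (h.trans (norm_eq_rpow_normExp p ha))]
  · rfl

/-- Hypothesis (i) of the no-go lemma holds in the exponent model ON THE NOSE: parameters of equal absolute value have the same
point. [folklore] -/
theorem pt_eq_of_absF_eq (x a : PadicAlgCl p) (h : (periodRingDatum p).absF x = (periodRingDatum p).absF a) :
    (periodRingDatum p).pt x = (periodRingDatum p).pt a := by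
  change absOne p x = absOne p a at h
  rw [absOne_apply, absOne_apply] at h
  exact expQ_eq_of_norm_eq p h

/-- `‖1 + p‖ = 1` in `Q̄_p` (ultrametric, `‖p‖ < 1`). [folklore] -/
private theorem norm_one_add_p : ‖(1 : PadicAlgCl p) + p‖ = 1 := by
  have hp1 : ‖(p : PadicAlgCl p)‖ < 1 := by
    have := (periodRingDatum p).abs0_p
    rw [show (periodRingDatum p).abs0 = absOne p from rfl, absOne_apply] at this
    exact this.2
  apply le_antisymm
  · calc ‖(1 : PadicAlgCl p) + p‖ ≤ max ‖(1 : PadicAlgCl p)‖ ‖(p : PadicAlgCl p)‖ := PadicAlgCl.isNonarchimedean p _ _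
      _ ≤ 1 := by rw [norm_one]; exact max_le le_rfl hp1.le
  · by_contra hlt
    push Not at hlt
    have h1 : ‖(1 : PadicAlgCl p)‖ ≤ max ‖(1 : PadicAlgCl p) + p‖ ‖(-(p : PadicAlgCl p))‖ := by
      have := PadicAlgCl.isNonarchimedean p ((1 : PadicAlgCl p) + p) (-(p : PadicAlgCl p))
      rwa [add_neg_cancel_right] at this
    rw [norm_one, norm_neg] at h1
    exact absurd h1 (not_le.2 (max_lt hlt hp1))

/-- Hypothesis (ii) of the no-go lemma in the exponent model, at the canonical parameter `a := p` (point `e(p) = 1`,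
`K_1 = Q̄_p` with `‖·‖^1`): `ξ := p + p² = p·(1 + p)` has `|ξ|_{K_1} = ‖p‖ = |p|_F` and `ξ ≠ p`. [folklore] -/
theorem absK_xi_and_ne :
    (periodRingDatum p).absK ((periodRingDatum p).pt (p : PadicAlgCl p)) ((p : PadicAlgCl p) + (p : PadicAlgCl p) ^ 2) =
        (periodRingDatum p).absF (p : PadicAlgCl p) ∧
      (p : PadicAlgCl p) + (p : PadicAlgCl p) ^ 2 ≠ ((periodRingDatum p).p : PadicAlgCl p) := by
  have hp0 : (p : PadicAlgCl p) ≠ 0 := by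
    have := (periodRingDatum p).abs0_p
    rw [show (periodRingDatum p).abs0 = absOne p from rfl, absOne_apply] at this
    exact norm_pos_iff.1 this.1
  refine ⟨?_, ?_⟩
  · change absPow p (sc (expQ p (p : PadicAlgCl p))) (sc_pos _) _ = absOne p (p : PadicAlgCl p)
    rw [absPow_apply, absOne_apply, expQ_p, sc_of_pos one_pos, Rat.cast_one, Real.rpow_one,
      show (p : PadicAlgCl p) + (p : PadicAlgCl p) ^ 2 = (p : PadicAlgCl p) * (1 + p) by ring, norm_mul, norm_one_add_p,
      mul_one]
  · change (p : PadicAlgCl p) + (p : PadicAlgCl p) ^ 2 ≠ (p : PadicAlgCl p)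
    intro h
    have : (p : PadicAlgCl p) ^ 2 = 0 := by
      have h' := congrArg (fun z => z - (p : PadicAlgCl p)) h
      simpa using h'
    exact pow_ne_zero 2 hp0 this

/-- **`EtaPtTeich` is FALSE in the exponent model** (`Joshi/PrototypeExponentModel`, p434861): its point map is the valuation exponent,
so the no-go lemma applies at `a := p`, `ξ := p + p²`. Together with p437626 (E-t2: TRUE in the transposed O1 model) the hypothesis
SEPARATES the two [J-IIp] models of record, in the opposite direction to the `ϕ^{−1}`-clause of Prop. 6.6.1 (p436434). [folklore] -/
theorem not_etaPtTeich : ¬ (periodRingDatum p).EtaPtTeich := by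
  have hp01 : 0 < ‖(p : PadicAlgCl p)‖ ∧ ‖(p : PadicAlgCl p)‖ < 1 := by
    have := (periodRingDatum p).abs0_p
    rwa [show (periodRingDatum p).abs0 = absOne p from rfl, absOne_apply] at this
  obtain ⟨hξ, hne⟩ := absK_xi_and_ne p
  refine (periodRingDatum p).not_etaPtTeich_of_pt_eq_of_absF_eq (a := (p : PadicAlgCl p)) (norm_pos_iff.1 hp01.1) ?_
    (fun x h => pt_eq_of_absF_eq p x _ h) hξ hne
  change absOne p (p : PadicAlgCl p) < 1
  rw [absOne_apply]; exact hp01.2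

/-- The same for the `PrototypeDatum` of the exponent model (its period-ring datum IS `periodRingDatum p`). [folklore] -/
theorem not_etaPtTeich_prototypeDatum : ¬ (prototypeDatum p).EtaPtTeich := not_etaPtTeich p

/-- **Census corollary (exponent-model side).** The exponent model carries E-t7's `↔`-form Frobenius invariance binder — its
point-Frobenius is a bijection (`frobY_bijective`, p434861) — and REFUTES `EtaPtTeich`; no file of record exhibits both at once.
[folklore] -/
theorem frobY_bijective_and_not_etaPtTeich :
    Function.Bijective (periodRingDatum p).frobY ∧ ¬ (periodRingDatum p).EtaPtTeich :=
  ⟨frobY_bijective p, not_etaPtTeich p⟩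

end ExpModel

end Summit.ABC.IUTFork.Joshi

end

-- tree-health (abc-iut-w6-d081 g4, 2026-08-26T12:15Z): comment-only re-land of a STRANDED ACCEPT (module accepted, no olean on hub/farm for > 60 min);
-- declarations byte-identical to the accepted version; purpose = trigger the rebuild (w4-d014 10:34:09Z remedy class). No content change.
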